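import Summits.HubbardSuperconductivity.HubbardSuperconductivity.Theorems.ThermalWedgeTwExponentialCeilingConditional
import Summits.HubbardSuperconductivity.HubbardSuperconductivity.Theorems.ThermalWedgeTwSectorEnergyLowerBound
import Summits.HubbardSuperconductivity.HubbardSuperconductivity.Theorems.ThermalWedgeTwApproximatingHamiltonian
import Summits.HubbardSuperconductivity.HubbardSuperconductivity.Theorems.ThermalWedgeTwSourcedInertnessReduction
import Literature.MathematicalPhysics.QuantumLattice.DWaveSourceFreeGainBound

/-!
# Route `ThermalWedge` — target-type support item `TwExponentialCeiling`
(stmt-HubbardSuperconductivity-1704): the ceiling functor and what it yields today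

`TwExponentialCeiling` (every normalised `(N_L, S^z = 0)`-sector ground state `ψ` of the PURE
repulsive torus `hubbardTorus 2 L 1 U` has `re⟨ψ,P_Lψ⟩/L⁴ ≤ C e^{-a/U}/U`, eventually in `L`, for
`0 < U ≤ U₀(δ)`) closes by the glue `TwCeilingGlue` (stmt-1705, proved: `twCeilingGlue_proof`) from
four inputs, two of which are proved in the tree (`twSectorEnergyLowerBound_proof`, stmt-1701;
`twApproximatingHamiltonian_proof`, stmt-1703) and two of which are open items of the route:
`TwPureThermalBound` (stmt-1702, standard ensemble equivalence, in progress) and the crux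
`TwSourcedInertness` (stmt-1696, Benfatto–Giuliani–Mastropietro-type convergent expansion WITH a
`d`-wave pair source at the summit's fillings — not in print).

This file isolates the exact use the ceiling makes of the positive-temperature input.

* `twec_ceilingEngineAt` — THE CEILING FUNCTOR, pointwise in `(δ,U,β,μ)` and assuming no item:
  a thermal upper bound `e_L(0) + p_L(β,μ,U,0) − μN_L/L² ≤ log 4/β + ε + D'` (eventually in `L`,
  every `ε > 0`) and a sourced-gain bound `p̃_L(β,μ,U,h) − p̃_L(β,μ,U,0) ≤ K h² + D` (all real `h`,
  eventually in `L`) yield, eventually in `L`, for every normalised sector ground state of the pure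
  model, `re⟨ψ,P_Lψ⟩/L⁴ ≤ K·(log 4/β + 2ε + D + D')` (chord at the inert seed `g₁ = 1/K`, sector
  lower bound, thermal bound, approximating Hamiltonian — the chain of the glue with the slacks
  carried along); `twec_ceilingEngine` — the same with the thermal bound supplied by
  `TwPureThermalBound` (stmt-1702, `D' = 0`) at its own `μ ∈ [μ₁,μ₂]`.
* `twec_thermalCeiling_free` — feeding the engine with the PROVED free inertness
  (`Literature…dWaveSource_free_sourcedGain_le`, `K = C₀(1+log β)`) and the interaction comparison
  `gain_U ≤ gain_0 + 2U` (`sourcedGain_le_free_add`, `D = 2U`):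
  `re⟨ψ,P_Lψ⟩/L⁴ ≤ C₀(1+log β)(log 4/β + 2ε + 2U)` for every `β ≥ 1`.
* `twec_legendreCeiling` — the optimal instance `β = 1/U`, `ε = U`: modulo stmt-1702 alone, every
  sector ground state of the weakly repulsive torus has `d`-wave pair order
  `re⟨ψ,P_Lψ⟩/L⁴ ≤ C·U·(1 + log(1/U))` (the "Legendre ceiling" of card probe-legendre-order-ceiling).
  The entropy price `log 4/β` forces `β → ∞` while the interaction slack `2U` is `β`-independent:
  this is precisely why the EXPONENTIAL ceiling needs the interacting susceptibility (stmt-1696),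
  which removes `D` for `β ≤ e^{a/U}`.
* `twec_exponentialCeiling_of_ceilingInertness` — the ceiling needs inertness ONLY at the single
  ceiling temperature `β = e^{a/U}` (hypothesis `CI`, the `β = e^{a/U}` slice of stmt-1696); with
  `twec_ceilingInertness_of_inertness` it re-proves the tree's
  `twExponentialCeiling_of_pureThermalBound_of_inertness` (`…ExponentialCeilingConditional.lean`,
  the glue at the two proved inputs; an `example` below), and `twExponentialCeiling_of_window`
  replaces the crux by its small-source window (via the tree's reduction
  `twSourcedInertness_of_free_of_window` and the proved free input).

Sources: the route's thesis (idea card thermal-wedge-entropy-sandwich); Griffiths (1965) / Ruelle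
(1969) §2.5 (Gibbs variational bounds); Bogoliubov Jr.–Brankov–Zagrebnov–Kurbatov–Tonchev (1984),
Bru–de Siqueira Pedra (2013) App. Thm 107 (approximating Hamiltonian); Benfatto–Giuliani–
Mastropietro, AHP 7 (2006) 809, Thm 1.1 (the regime `T ≥ e^{-a/U}`).
-/

namespace Summit.HubbardSuperconductivity.HubbardSuperconductivity.Theorems

open Literature.MathematicalPhysics.QuantumLattice Matrix
open Summit.HubbardSuperconductivity.HubbardSuperconductivity.Theses.ThermalWedge
open Summit.HubbardSuperconductivity.TwTipContinuation.Negative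

/-! ### Bookkeeping -/

/-- The real-arithmetic core of the ceiling chain with slacks `D` (inertness) and `D'` (thermal
bound): chord + sector lower bound + thermal bound + approximating Hamiltonian + inertness give
`P/L⁴ ≤ (log4/β + 2ε + D + D')/g₁`. [folklore] -/
theorem twec_bookkeeping {E₀ E₁ P pg p₀ ph n n' g₁ L β ε K D D' lb h : ℝ} (hL : 0 < L)
    (hg₁ : 0 < g₁) (hchord : (g₁ - 0) / L ^ 2 * P ≤ E₀ - E₁) (hlow : n - pg ≤ E₁ / L ^ 2)
    (hup : E₀ / L ^ 2 + p₀ - n' ≤ lb / β + ε + D') (hn : n = n') (hh : pg ≤ ph - h ^ 2 / g₁ + ε)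
    (hin : ph - p₀ ≤ K * h ^ 2 + D) (hkey : h ^ 2 / g₁ = K * h ^ 2) :
    P / L ^ 4 ≤ (lb / β + 2 * ε + D + D') / g₁ := by
  have hL2 : 0 < L ^ 2 := by positivity
  subst hn
  have hpg : pg ≤ p₀ + ε + D := by linarith
  have he : (E₀ - E₁) / L ^ 2 ≤ lb / β + 2 * ε + D + D' := by
    rw [sub_div]
    linarith
  have hc : (g₁ - 0) / L ^ 2 * P / L ^ 2 ≤ (E₀ - E₁) / L ^ 2 :=
    div_le_div_of_nonneg_right hchord hL2.le
  have hre : (g₁ - 0) / L ^ 2 * P / L ^ 2 = g₁ * (P / L ^ 4) := by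
    field_simp
    ring
  rw [le_div_iff₀ hg₁, mul_comm]
  linarith

/-! ### The ceiling engine -/

/-- **The ceiling functor, pointwise form** (no item assumed; every real `U`, `β > 0`, `μ`, `K > 0`,
slacks `D, D'`). Suppose, for the `(N_L, S^z=0)` sector of `hubbardTorus 2 L 1 U`
(`N_L = 2⌊(1−δ)L²/2⌋`):
(T) a thermal upper bound `e_L(0) + p_L(β,μ,U,0) − μN_L/L² ≤ log 4/β + ε + D'` eventually in `L`
    for every `ε > 0` (with `D' = 0` this is the body of `TwPureThermalBound` at `(δ,U,β,μ)`; a free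
    Slater trial state gives it with `D' = U/2`), and
(G) a sourced-gain bound `p̃_L(β,μ,U,h) − p̃_L(β,μ,U,0) ≤ K h² + D` for all real `h`, eventually in
    `L` (with `D = 0`, `K = C(1+log β)` this is the body of `TwSourcedInertness` at `(U,β,μ)`; the
    free inertness and the interaction comparison give it with `K = C₀(1+log β)`, `D = 2U`).
Then for every `ε > 0`, eventually in `L`, every normalised sector ground state `ψ` of the pure
torus has `re⟨ψ,P_Lψ⟩/L⁴ ≤ K (log 4/β + 2ε + D + D')`.
Chain (seed `g₁ = 1/K`): `g₁⟨P_L⟩/L⁴ ≤ e(0) − e(g₁)` (ceiling chord),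
`e(g₁) ≥ μn − p_L(g₁)` (`twSectorEnergyLowerBound_proof`), `e(0) ≤ μn − p_L(0) + log4/β + ε + D'` (T),
`p_L(g₁) ≤ p̃_L(h_L) − h_L²/g₁ + ε` (`twApproximatingHamiltonian_proof`, hard half)
`≤ p̃_L(0) + D + ε = p_L(0) + D + ε` (G). [folklore] -/
theorem twec_ceilingEngineAt {δ U β μ K D D' : ℝ} (hβ : 0 < β) (hK : 0 < K)
    (hT : ∀ ε : ℝ, 0 < ε → ∃ L₀ : ℕ, ∀ (L : ℕ) [NeZero L], L₀ ≤ L →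
      ((hubbardTorus 2 L 1 U).minEnergyOn
            (szSector (Λ := FermionTorus 2 L) (2 * ⌊(1 - δ) * (L : ℝ) ^ 2 / 2⌋₊) 0) / (L : ℝ) ^ 2) +
          (Real.log (partitionFn β (hubbardTorusWith 2 L 1 U μ)).re / (β * (L : ℝ) ^ 2)) -
          μ * ((2 * ⌊(1 - δ) * (L : ℝ) ^ 2 / 2⌋₊) : ℝ) / (L : ℝ) ^ 2 ≤ Real.log 4 / β + ε + D')
    (hG : ∃ L₀ : ℕ, ∀ (L : ℕ) [NeZero L], L₀ ≤ L → ∀ h : ℝ,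
      Real.log (partitionFn β (dWaveSourceTorus L U μ h)).re / (β * (L : ℝ) ^ 2) -
          Real.log (partitionFn β (dWaveSourceTorus L U μ 0)).re / (β * (L : ℝ) ^ 2) ≤
        K * h ^ 2 + D) :
    ∀ ε : ℝ, 0 < ε → ∃ L₀ : ℕ, ∀ (L : ℕ) [NeZero L], L₀ ≤ L →
      ∀ ψ : Fock (Orb (FermionTorus 2 L)), star ψ ⬝ᵥ ψ = 1 →
        IsGroundStateInSector (hubbardTorus 2 L 1 U) (2 * ⌊(1 - δ) * (L : ℝ) ^ 2 / 2⌋₊) 0 ψ →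
          (expect ((pairField dWaveFormFactor L)ᴴ * pairField dWaveFormFactor L) ψ).re /
              (L : ℝ) ^ 4 ≤ K * (Real.log 4 / β + 2 * ε + D + D') := by
  intro ε hε
  obtain ⟨L₁, hL₁⟩ := hT ε hε
  obtain ⟨L₂, hL₂⟩ := hG
  set g₁ : ℝ := 1 / K with hg₁def
  have hg₁ : 0 < g₁ := div_pos one_pos hK
  obtain ⟨-, hHard⟩ := twApproximatingHamiltonian_proof U μ β g₁ hβ hg₁
  obtain ⟨L₃, hL₃⟩ := hHard ε hε
  refine ⟨max L₁ (max L₂ L₃), ?_⟩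
  intro L _ hL ψ hψ hgs
  have hLmax : max L₂ L₃ ≤ L := (le_max_right _ _).trans hL
  have hL1 : L₁ ≤ L := (le_max_left _ _).trans hL
  have hL2 : L₂ ≤ L := (le_max_left _ _).trans hLmax
  have hL3 : L₃ ≤ L := (le_max_right _ _).trans hLmax
  have hLpos : (0 : ℝ) < (L : ℝ) := by exact_mod_cast NeZero.pos L
  -- the ceiling chord at `g = 0 < g₁`
  have hgs' : IsGroundStateInSector (hubbardTorus 2 L 1 U - ((0 / (L : ℝ) ^ 2 : ℝ) : ℂ) •
      ((pairField dWaveFormFactor L)ᴴ * pairField dWaveFormFactor L))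
      (2 * ⌊(1 - δ) * (L : ℝ) ^ 2 / 2⌋₊) 0 ψ := by
    rw [seededH_zero]; exact hgs
  have hchord := order_le_rightChord (U := U) (g := 0) (g'' := g₁) hg₁ hψ hgs'
  rw [seededH_zero] at hchord
  -- the sector is inhabited by `ψ`
  have hV : szSector (Λ := FermionTorus 2 L) (2 * ⌊(1 - δ) * (L : ℝ) ^ 2 / 2⌋₊) 0 ≠ ⊥ :=
    (Submodule.ne_bot_iff _).2 ⟨ψ, hgs.1, hgs.2.1⟩
  have hlow := twSectorEnergyLowerBound_proof L (2 * ⌊(1 - δ) * (L : ℝ) ^ 2 / 2⌋₊) U μ β g₁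
    hβ hV
  have hup := hL₁ L hL1
  have hn : μ * ((2 * ⌊(1 - δ) * (L : ℝ) ^ 2 / 2⌋₊ : ℕ) : ℝ) / (L : ℝ) ^ 2 =
      μ * ((2 * ⌊(1 - δ) * (L : ℝ) ^ 2 / 2⌋₊) : ℝ) / (L : ℝ) ^ 2 := by
    push_cast; ring
  obtain ⟨h, hh⟩ := hL₃ L hL3
  have hin := hL₂ L hL2 h
  rw [dWaveSourceTorus_zero] at hin
  have hkey : h ^ 2 / g₁ = K * h ^ 2 := by
    rw [hg₁def, div_div_eq_mul_div, div_one]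
    ring
  have hmain := twec_bookkeeping hLpos hg₁ hchord hlow hup hn hh hin hkey
  have hg₁inv : (Real.log 4 / β + 2 * ε + D + D') / g₁ = K * (Real.log 4 / β + 2 * ε + D + D') := by
    rw [hg₁def, div_div_eq_mul_div, div_one]
    ring
  rw [hg₁inv] at hmain
  exact hmain

/-- **The ceiling functor modulo `TwPureThermalBound`** (stmt-1702). For `δ ∈ [1/10,2/5]` take its
`μ`-window `[μ₁,μ₂] ⊂ (−4,0)` and threshold `U₀`. Then for `0 < U ≤ U₀`, `β ≥ 1`, `K > 0` and any
`D`: if the sourced pressure gain of the interacting torus obeys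
`p̃_L(β,μ,U,h) − p̃_L(β,μ,U,0) ≤ K h² + D` for all real `h`, eventually in `L`, for every
`μ ∈ [μ₁,μ₂]`, then for every `ε > 0`, eventually in `L`, every normalised `(N_L,S^z=0)`-sector
ground state `ψ` of `hubbardTorus 2 L 1 U` has `re⟨ψ,P_Lψ⟩/L⁴ ≤ K (log 4/β + 2ε + D)`
(`twec_ceilingEngineAt` at the `μ` of the thermal bound, `D' = 0`). [folklore] -/
theorem twec_ceilingEngine (hP : TwPureThermalBound) :
    ∀ δ ∈ Set.Icc (1/10 : ℝ) (2/5 : ℝ), ∃ μ₁ μ₂ : ℝ, -4 < μ₁ ∧ μ₁ ≤ μ₂ ∧ μ₂ < 0 ∧ ∃ U₀ : ℝ,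
      0 < U₀ ∧ ∀ U ∈ Set.Ioc (0 : ℝ) U₀, ∀ β : ℝ, 1 ≤ β → ∀ K D : ℝ, 0 < K →
        (∀ μ ∈ Set.Icc μ₁ μ₂, ∃ L₀ : ℕ, ∀ (L : ℕ) [NeZero L], L₀ ≤ L → ∀ h : ℝ,
          Real.log (partitionFn β (dWaveSourceTorus L U μ h)).re / (β * (L : ℝ) ^ 2) -
              Real.log (partitionFn β (dWaveSourceTorus L U μ 0)).re / (β * (L : ℝ) ^ 2) ≤
            K * h ^ 2 + D) →
        ∀ ε : ℝ, 0 < ε → ∃ L₀ : ℕ, ∀ (L : ℕ) [NeZero L], L₀ ≤ L →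
          ∀ ψ : Fock (Orb (FermionTorus 2 L)), star ψ ⬝ᵥ ψ = 1 →
            IsGroundStateInSector (hubbardTorus 2 L 1 U) (2 * ⌊(1 - δ) * (L : ℝ) ^ 2 / 2⌋₊) 0 ψ →
              (expect ((pairField dWaveFormFactor L)ᴴ * pairField dWaveFormFactor L) ψ).re /
                  (L : ℝ) ^ 4 ≤ K * (Real.log 4 / β + 2 * ε + D) := by
  intro δ hδ
  obtain ⟨μ₁, μ₂, hμ₁, hμ₁₂, hμ₂, U₀, hU₀, hP'⟩ := hP δ hδ
  refine ⟨μ₁, μ₂, hμ₁, hμ₁₂, hμ₂, U₀, hU₀, ?_⟩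
  intro U hU β hβ1 K D hK hGain ε hε
  have hβpos : 0 < β := lt_of_lt_of_le one_pos hβ1
  obtain ⟨μ, hμ, hP''⟩ := hP' U hU β hβ1
  have hT : ∀ ε : ℝ, 0 < ε → ∃ L₀ : ℕ, ∀ (L : ℕ) [NeZero L], L₀ ≤ L →
      ((hubbardTorus 2 L 1 U).minEnergyOn
            (szSector (Λ := FermionTorus 2 L) (2 * ⌊(1 - δ) * (L : ℝ) ^ 2 / 2⌋₊) 0) / (L : ℝ) ^ 2) +
          (Real.log (partitionFn β (hubbardTorusWith 2 L 1 U μ)).re / (β * (L : ℝ) ^ 2)) -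
          μ * ((2 * ⌊(1 - δ) * (L : ℝ) ^ 2 / 2⌋₊) : ℝ) / (L : ℝ) ^ 2 ≤ Real.log 4 / β + ε + 0 := by
    intro ε' hε'
    obtain ⟨L₀, hL₀⟩ := hP'' ε' hε'
    exact ⟨L₀, fun L _ hL => by simpa only [add_zero] using hL₀ L hL⟩
  obtain ⟨L₀, hL₀⟩ := twec_ceilingEngineAt (D := D) hβpos hK hT (hGain μ hμ) ε hε
  exact ⟨L₀, fun L _ hL ψ hψ hgs => by simpa only [add_zero] using hL₀ L hL ψ hψ hgs⟩

/-! ### What the proved (free) inertness gives: the thermal / Legendre ceiling -/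

/-- **Thermal ceiling from the FREE inertness** (modulo stmt-1702). For `δ ∈ [1/10,2/5]` there are
`U₀, C₀ > 0` such that for `0 < U ≤ U₀`, every `β ≥ 1` and `ε > 0`, eventually in `L`, every
normalised sector ground state `ψ` of the pure torus has
`re⟨ψ,P_Lψ⟩/L⁴ ≤ C₀(1 + log β)(log 4/β + 2ε + 2U)`: the engine fed with the free `d`-wave pair
susceptibility `p̃_L(β,μ,0,s) − p̃_L(β,μ,0,0) ≤ C₀(1+log β)s²` (proved in the tree) and the
interaction comparison `gain_U ≤ gain_0 + 2U`. [folklore] -/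
theorem twec_thermalCeiling_free (hP : TwPureThermalBound) :
    ∀ δ ∈ Set.Icc (1/10 : ℝ) (2/5 : ℝ), ∃ U₀ C₀ : ℝ, 0 < U₀ ∧ 0 < C₀ ∧
      ∀ U ∈ Set.Ioc (0 : ℝ) U₀, ∀ β : ℝ, 1 ≤ β → ∀ ε : ℝ, 0 < ε → ∃ L₀ : ℕ,
        ∀ (L : ℕ) [NeZero L], L₀ ≤ L → ∀ ψ : Fock (Orb (FermionTorus 2 L)), star ψ ⬝ᵥ ψ = 1 →
          IsGroundStateInSector (hubbardTorus 2 L 1 U) (2 * ⌊(1 - δ) * (L : ℝ) ^ 2 / 2⌋₊) 0 ψ →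
            (expect ((pairField dWaveFormFactor L)ᴴ * pairField dWaveFormFactor L) ψ).re /
                (L : ℝ) ^ 4 ≤ C₀ * (1 + Real.log β) * (Real.log 4 / β + 2 * ε + 2 * U) := by
  intro δ hδ
  obtain ⟨μ₁, μ₂, hμ₁, hμ₁₂, hμ₂, U₀, hU₀, hEng⟩ := twec_ceilingEngine hP δ hδ
  obtain ⟨C₀, hC₀, hFree⟩ := dWaveSource_free_sourcedGain_le μ₁ μ₂ hμ₁ hμ₁₂ hμ₂
  refine ⟨U₀, C₀, hU₀, hC₀, ?_⟩
  intro U hU β hβ1 ε hε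
  have hU0 : 0 < U := hU.1
  have hβpos : 0 < β := lt_of_lt_of_le one_pos hβ1
  have hlog : 0 < 1 + Real.log β := by
    have := Real.log_nonneg hβ1
    linarith
  have hK : 0 < C₀ * (1 + Real.log β) := mul_pos hC₀ hlog
  have hGain : ∀ μ ∈ Set.Icc μ₁ μ₂, ∃ L₀ : ℕ, ∀ (L : ℕ) [NeZero L], L₀ ≤ L → ∀ h : ℝ,
      Real.log (partitionFn β (dWaveSourceTorus L U μ h)).re / (β * (L : ℝ) ^ 2) -
          Real.log (partitionFn β (dWaveSourceTorus L U μ 0)).re / (β * (L : ℝ) ^ 2) ≤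
        C₀ * (1 + Real.log β) * h ^ 2 + 2 * U := by
    intro μ hμ
    obtain ⟨L₀, hL₀⟩ := hFree β hβ1 μ hμ
    refine ⟨L₀, fun L _ hL h => ?_⟩
    have hfree := hL₀ L hL h
    have hcomp := sourcedGain_le_free_add L U μ h hβpos
    rw [abs_of_pos hU0] at hcomp
    linarith
  have key := hEng U hU β hβ1 (C₀ * (1 + Real.log β)) (2 * U) hK hGain ε hε
  simpa only [mul_assoc] using key

/-- **The Legendre ceiling** (modulo stmt-1702 `TwPureThermalBound` alone; otherwise unconditional):
for `δ ∈ [1/10,2/5]` there are `U₀, C > 0` such that for `0 < U ≤ U₀`, eventually in `L`, EVERY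
normalised `(N_L,S^z=0)`-sector ground state `ψ` of the weakly repulsive torus `hubbardTorus 2 L 1 U`
has `d`-wave pair order `re⟨ψ,P_Lψ⟩/L⁴ ≤ C·U·(1 + log(1/U))` — the thermal ceiling at `β = 1/U`,
`ε = U`, with `C = C₀(log 4 + 4)`. Compare `TwExponentialCeiling` (`C e^{-a/U}/U`), which needs the
interacting pair susceptibility (stmt-1696) in place of the free one. [folklore] -/
theorem twec_legendreCeiling (hP : TwPureThermalBound) :
    ∀ δ ∈ Set.Icc (1/10 : ℝ) (2/5 : ℝ), ∃ U₀ C : ℝ, 0 < U₀ ∧ 0 < C ∧ ∀ U ∈ Set.Ioc (0 : ℝ) U₀,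
      ∃ L₀ : ℕ, ∀ (L : ℕ) [NeZero L], L₀ ≤ L → ∀ ψ : Fock (Orb (FermionTorus 2 L)),
        star ψ ⬝ᵥ ψ = 1 →
          IsGroundStateInSector (hubbardTorus 2 L 1 U) (2 * ⌊(1 - δ) * (L : ℝ) ^ 2 / 2⌋₊) 0 ψ →
            (expect ((pairField dWaveFormFactor L)ᴴ * pairField dWaveFormFactor L) ψ).re /
                (L : ℝ) ^ 4 ≤ C * U * (1 + Real.log (1 / U)) := by
  intro δ hδ
  obtain ⟨U₀, C₀, hU₀, hC₀, hT⟩ := twec_thermalCeiling_free hP δ hδ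
  have hlog4 : 0 < Real.log 4 := Real.log_pos (by norm_num)
  refine ⟨min U₀ 1, C₀ * (Real.log 4 + 4), lt_min hU₀ one_pos, by positivity, ?_⟩
  intro U hU
  obtain ⟨hU0, hUle⟩ := hU
  have hUU₀ : U ≤ U₀ := hUle.trans (min_le_left _ _)
  have hU1 : U ≤ 1 := hUle.trans (min_le_right _ _)
  have hβ1 : (1 : ℝ) ≤ 1 / U := by
    rw [le_div_iff₀ hU0]
    linarith
  obtain ⟨L₀, hL₀⟩ := hT U ⟨hU0, hUU₀⟩ (1 / U) hβ1 U hU0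
  refine ⟨L₀, fun L _ hL ψ hψ hgs => ?_⟩
  have key := hL₀ L hL ψ hψ hgs
  have e : C₀ * (1 + Real.log (1 / U)) * (Real.log 4 / (1 / U) + 2 * U + 2 * U) =
      C₀ * (Real.log 4 + 4) * U * (1 + Real.log (1 / U)) := by
    field_simp
    ring
  linarith [key, e.le, e.ge]

/-! ### The exponential ceiling: exactly what it needs from the crux -/

/-- **The exponential ceiling from inertness AT THE CEILING TEMPERATURE** (modulo stmt-1702).
Hypothesis `CI` is the single-temperature slice `β = e^{a/U}` of the crux `TwSourcedInertness`
(stmt-1696): for every compact `[μ₁,μ₂] ⊂ (−4,0)` there are `U₀,a,C > 0` with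
`p̃_L(e^{a/U},μ,U,h) − p̃_L(e^{a/U},μ,U,0) ≤ C(1 + a/U)h²` for all real `h`, eventually in `L`,
for `0 < U ≤ U₀`, `μ ∈ [μ₁,μ₂]`. The engine at `β = e^{a/U}`, `K = C(1 + a/U)`, `D = 0`,
`ε = e^{-a/U}` gives `re⟨ψ,P_Lψ⟩/L⁴ ≤ C(a + U₀)(log 4 + 2)·e^{-a/U}/U`. [folklore] -/
theorem twec_exponentialCeiling_of_ceilingInertness (hP : TwPureThermalBound)
    (hCI : ∀ μ₁ μ₂ : ℝ, -4 < μ₁ → μ₁ ≤ μ₂ → μ₂ < 0 → ∃ U₀ a C : ℝ, 0 < U₀ ∧ 0 < a ∧ 0 < C ∧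
      ∀ U : ℝ, 0 < U → U ≤ U₀ → ∀ μ ∈ Set.Icc μ₁ μ₂, ∃ L₀ : ℕ, ∀ (L : ℕ) [NeZero L], L₀ ≤ L →
        ∀ h : ℝ,
          Real.log (partitionFn (Real.exp (a / U)) (dWaveSourceTorus L U μ h)).re /
                (Real.exp (a / U) * (L : ℝ) ^ 2) -
              Real.log (partitionFn (Real.exp (a / U)) (dWaveSourceTorus L U μ 0)).re /
                (Real.exp (a / U) * (L : ℝ) ^ 2) ≤
            C * (1 + a / U) * h ^ 2) :
    TwExponentialCeiling := by
  intro δ hδ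
  obtain ⟨μ₁, μ₂, hμ₁, hμ₁₂, hμ₂, U₀p, hU₀p, hEng⟩ := twec_ceilingEngine hP δ hδ
  obtain ⟨U₀i, a, C, hU₀i, ha, hC, hI⟩ := hCI μ₁ μ₂ hμ₁ hμ₁₂ hμ₂
  have hlog4 : 0 < Real.log 4 := Real.log_pos (by norm_num)
  refine ⟨min U₀p U₀i, a, C * (a + U₀i) * (Real.log 4 + 2), lt_min hU₀p hU₀i, ha,
    by positivity, ?_⟩
  intro U hU
  obtain ⟨hU0, hUle⟩ := hU
  have hUp : U ≤ U₀p := hUle.trans (min_le_left _ _)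
  have hUi : U ≤ U₀i := hUle.trans (min_le_right _ _)
  have haU : 0 < a / U := div_pos ha hU0
  set β : ℝ := Real.exp (a / U) with hβdef
  have hβ1 : 1 ≤ β := Real.one_le_exp haU.le
  have hK : 0 < C * (1 + a / U) := by positivity
  set ε : ℝ := Real.exp (-a / U) with hεdef
  have hε : 0 < ε := Real.exp_pos _
  have hεβ : ε = β⁻¹ := by rw [hεdef, hβdef, neg_div, Real.exp_neg]
  have hGain : ∀ μ ∈ Set.Icc μ₁ μ₂, ∃ L₀ : ℕ, ∀ (L : ℕ) [NeZero L], L₀ ≤ L → ∀ h : ℝ,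
      Real.log (partitionFn β (dWaveSourceTorus L U μ h)).re / (β * (L : ℝ) ^ 2) -
          Real.log (partitionFn β (dWaveSourceTorus L U μ 0)).re / (β * (L : ℝ) ^ 2) ≤
        C * (1 + a / U) * h ^ 2 + 0 := by
    intro μ hμ
    obtain ⟨L₀, hL₀⟩ := hI U hU0 hUi μ hμ
    exact ⟨L₀, fun L _ hL h => by simpa only [add_zero] using hL₀ L hL h⟩
  obtain ⟨L₀, hL₀⟩ := hEng U ⟨hU0, hUp⟩ β hβ1 (C * (1 + a / U)) 0 hK hGain ε hε
  refine ⟨L₀, fun L _ hL ψ hψ hgs => ?_⟩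
  have key := hL₀ L hL ψ hψ hgs
  -- constants
  have h1aU : 1 + a / U ≤ (a + U₀i) / U := by
    rw [show (1 : ℝ) + a / U = (U + a) / U by rw [add_div, div_self hU0.ne']]
    exact div_le_div_of_nonneg_right (by linarith) hU0.le
  have hval : C * (1 + a / U) * (Real.log 4 / β + 2 * ε + 0) =
      ε * (Real.log 4 + 2) * C * (1 + a / U) := by
    rw [hεβ]
    ring
  have hεC : 0 ≤ ε * (Real.log 4 + 2) * C := by positivity
  calc _ ≤ C * (1 + a / U) * (Real.log 4 / β + 2 * ε + 0) := key
    _ = ε * (Real.log 4 + 2) * C * (1 + a / U) := hval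
    _ ≤ ε * (Real.log 4 + 2) * C * ((a + U₀i) / U) := mul_le_mul_of_nonneg_left h1aU hεC
    _ = C * (a + U₀i) * (Real.log 4 + 2) * ε / U := by ring

/-- The crux `TwSourcedInertness` (all `1 ≤ β ≤ e^{a/U}`) implies its ceiling-temperature slice
`CI` (`β = e^{a/U}`, `log β = a/U`). [folklore] -/
theorem twec_ceilingInertness_of_inertness (hI : TwSourcedInertness) :
    ∀ μ₁ μ₂ : ℝ, -4 < μ₁ → μ₁ ≤ μ₂ → μ₂ < 0 → ∃ U₀ a C : ℝ, 0 < U₀ ∧ 0 < a ∧ 0 < C ∧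
      ∀ U : ℝ, 0 < U → U ≤ U₀ → ∀ μ ∈ Set.Icc μ₁ μ₂, ∃ L₀ : ℕ, ∀ (L : ℕ) [NeZero L], L₀ ≤ L →
        ∀ h : ℝ,
          Real.log (partitionFn (Real.exp (a / U)) (dWaveSourceTorus L U μ h)).re /
                (Real.exp (a / U) * (L : ℝ) ^ 2) -
              Real.log (partitionFn (Real.exp (a / U)) (dWaveSourceTorus L U μ 0)).re /
                (Real.exp (a / U) * (L : ℝ) ^ 2) ≤
            C * (1 + a / U) * h ^ 2 := by
  intro μ₁ μ₂ hμ₁ hμ₁₂ hμ₂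
  obtain ⟨U₀, a, C, hU₀, ha, hC, hI'⟩ := hI μ₁ μ₂ hμ₁ hμ₁₂ hμ₂
  refine ⟨U₀, a, C, hU₀, ha, hC, fun U hU0 hUU₀ μ hμ => ?_⟩
  have haU : 0 < a / U := div_pos ha hU0
  have hβ1 : 1 ≤ Real.exp (a / U) := Real.one_le_exp haU.le
  obtain ⟨L₀, hL₀⟩ := hI' U hU0 hUU₀ (Real.exp (a / U)) hβ1 le_rfl μ hμ
  refine ⟨L₀, fun L _ hL h => ?_⟩
  have := hL₀ L hL h
  rwa [Real.log_exp] at this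

-- `TwExponentialCeiling` modulo stmt-1702 and stmt-1696 through the engine at the ceiling
-- temperature: the same implication as the tree's `twExponentialCeiling_of_pureThermalBound_of_inertness`
-- (the glue `twCeilingGlue_proof` at the two proved inputs); `example`s, so as not to duplicate it.
example (hP : TwPureThermalBound) (hI : TwSourcedInertness) : TwExponentialCeiling :=
  twec_exponentialCeiling_of_ceilingInertness hP (twec_ceilingInertness_of_inertness hI)

example (hP : TwPureThermalBound) (hI : TwSourcedInertness) : TwExponentialCeiling :=
  twExponentialCeiling_of_pureThermalBound_of_inertness hP hI

/-- **`TwExponentialCeiling` modulo stmt-1702 and the small-source WINDOW of the crux only**: by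
the tree's reduction `twSourcedInertness_of_free_of_window` and the proved free input
`dWaveSource_free_sourcedGain_le`, the crux may be replaced by its restriction to sources with
`h²(1 + log β) ≤ κU` (the interacting `d`-wave pair susceptibility in the linear-response regime —
the irreducible constructive content). [folklore] -/
theorem twExponentialCeiling_of_window (hP : TwPureThermalBound)
    (hW : ∀ μ₁ μ₂ : ℝ, -4 < μ₁ → μ₁ ≤ μ₂ → μ₂ < 0 → ∃ U₀ a C κ : ℝ, 0 < U₀ ∧ 0 < a ∧ 0 < C ∧
      0 < κ ∧ ∀ U : ℝ, 0 < U → U ≤ U₀ → ∀ β : ℝ, 1 ≤ β → β ≤ Real.exp (a / U) →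
        ∀ μ ∈ Set.Icc μ₁ μ₂, ∃ L₀ : ℕ, ∀ (L : ℕ) [NeZero L], L₀ ≤ L → ∀ h : ℝ,
          h ^ 2 * (1 + Real.log β) ≤ κ * U →
          Real.log (partitionFn β (dWaveSourceTorus L U μ h)).re / (β * (L : ℝ) ^ 2) -
              Real.log (partitionFn β (dWaveSourceTorus L U μ 0)).re / (β * (L : ℝ) ^ 2) ≤
            C * (1 + Real.log β) * h ^ 2) :
    TwExponentialCeiling :=
  twExponentialCeiling_of_pureThermalBound_of_inertness hP
    (twSourcedInertness_of_free_of_window dWaveSource_free_sourcedGain_le hW)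

end Summit.HubbardSuperconductivity.HubbardSuperconductivity.Theorems
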